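import Literature.Analysis.Fourier.ParametricFourierSlices
import Literature.Analysis.Fourier.LpMultiplierConstant
import Literature.Barriers.AtomisticToContinuum.NoBVEstimatesMultiDLinearStep
import Literature.Barriers.AtomisticToContinuum.NoBVEstimatesMultiDFinitePropagationEnergy
import HarnessLib

/-!
# The Fourier representation `v̂(t, ξ) = M_t(ξ) φ̂(ξ)` of compactly supported classical
solutions of the constant-coefficient system (Rauch's multiplier as the solution symbol)

For the constant-coefficient system `A₀∂ₜv + Σⱼ Aⱼ∂ⱼv + B₁v = 0` (`ofConstant A₀ A B₁`, `A₀`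
invertible) and a classical solution `v` on `[0, T] × ℝᵈ` which vanishes for `‖x‖ > ρ`
uniformly in `t ∈ [0, T]`, the spatial Fourier transform of the (complexified) slices is
propagated by Rauch's multiplier [Rauch1986, Proof of Theorem p. 483]:

  `𝓕(v(t))(ξ) = rauchSymbol A₀ A B₁ t ξ · 𝓕(v(0))(ξ)`,  `rauchSymbol A₀ A B₁ t ξ =
  exp(-t A₀⁻¹(2πi Σ ξⱼAⱼ + B₁))`  (`fourier_cplx_slice_eq_rauchSymbol_mulVec`)

— Brenner's `û(t, ξ) = exp(tP(ξ))û₀(ξ)` [Brenner1973, Lemma 5.1 (5.12) p. 96] for this class,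
including UNIQUENESS of such solutions given the data. Proof: transform the equation at interior
times (`𝓕(∂ⱼg) = 2πiξⱼ𝓕g`, constant matrices commute with `𝓕`; integrability from the compact
support), differentiate `t ↦ 𝓕(v(t))(ξ)` under the integral sign
(`Literature.Analysis.Fourier.hasDerivAt_fourier_slice`), obtaining the linear ODE
`ŵ' = -rauchGenerator(ξ) ŵ` on `(0, T)` with `ŵ` continuous on `[0, T]`, and conclude by
`Literature.Analysis.Fourier.eq_exp_neg_mulVec_of_hasDerivAt`.

The uniform compact support is supplied by finite speed of propagation
(`fourier_cplx_slice_eq_of_hasPropagationSpeed`: data supported in `‖x‖ ≤ R` and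
`HasPropagationSpeed (ofConstant A₀ A B₁) 0 c` give `ρ = R + cT`), which holds for the
symmetrizable branch of Rauch's class (`Rauch1986_finitePropagationSpeed_symmetrizable_holds`)
and is the named fact `Rauch1986_finitePropagationSpeed_strictlyHyperbolic` otherwise. This is
the step "`v(t̄) = M(D)φ`" by which hypothesis (5) of the named fact
`Rauch1986_L1GradientEstimate_imp_LpMultiplier` becomes a statement about the multiplier
`M = rauchSymbol A₀ A B₁ T`.

## References

* [Rauch1986] J. Rauch, Comm. Math. Phys. 106 (1986) 481–484, Proof of Theorem p. 483, (4)–(5).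
* [Brenner1973] P. Brenner, Ark. Mat. 11 (1973) 75–101, §5 p. 92 and Lemma 5.1 (5.12) p. 96.
-/

noncomputable section

open MeasureTheory Set Filter Matrix FourierTransform
open scoped Topology RealInnerProductSpace

namespace Literature.Barriers.AtomisticToContinuum

open Literature.Analysis.Fourier Literature.Analysis.FluidPDE QuasilinearSystem

variable {d k : ℕ}

/-! ### Linearity of `𝓕` at a point (integrable summands) -/

/-- The Fourier integrand of an integrable function is integrable. [folklore] -/
theorem integrable_fourierKernel_smul {g : Space d → Fin k → ℂ} (hg : Integrable g) (ξ : Space d) :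
    Integrable fun v : Space d => 𝐞 (-⟪v, ξ⟫) • g v :=
  (Real.fourierIntegral_convergent_iff' (innerSL ℝ) ξ).2 hg

/-- `𝓕(f + g)(ξ) = 𝓕f(ξ) + 𝓕g(ξ)` for integrable `f, g`. [folklore] -/
theorem fourier_add_apply {f g : Space d → Fin k → ℂ} (hf : Integrable f) (hg : Integrable g)
    (ξ : Space d) : 𝓕 (fun x => f x + g x) ξ = 𝓕 f ξ + 𝓕 g ξ := by
  rw [Real.fourier_eq, Real.fourier_eq, Real.fourier_eq,
    ← integral_add (integrable_fourierKernel_smul hf ξ) (integrable_fourierKernel_smul hg ξ)]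
  exact integral_congr_ae (Eventually.of_forall fun v => smul_add _ _ _)

/-- `𝓕(Σⱼ fⱼ)(ξ) = Σⱼ 𝓕fⱼ(ξ)` for integrable `fⱼ`. [folklore] -/
theorem fourier_finset_sum_apply {f : Fin d → Space d → Fin k → ℂ} (hf : ∀ j, Integrable (f j))
    (ξ : Space d) : 𝓕 (fun x => ∑ j, f j x) ξ = ∑ j, 𝓕 (f j) ξ := by
  simp_rw [Real.fourier_eq]
  rw [← integral_finsetSum _ fun j _ => integrable_fourierKernel_smul (hf j) ξ]
  exact integral_congr_ae (Eventually.of_forall fun v => Finset.smul_sum)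

/-- `𝓕(0) = 0`. [folklore] -/
theorem fourier_zero_apply (ξ : Space d) : 𝓕 (fun _ : Space d => (0 : Fin k → ℂ)) ξ = 0 := by
  rw [Real.fourier_eq]
  simp [Circle.smul_def]

/-! ### The complexified equation of a classical solution of the constant-coefficient system -/

section Solution

variable {A₀ : Matrix (Fin k) (Fin k) ℝ} {A : Fin d → Matrix (Fin k) (Fin k) ℝ}
  {B₁ : (Fin k → ℝ) →L[ℝ] (Fin k → ℝ)} {T ρ : ℝ} {v : ℝ → Space d → Fin k → ℝ}

/-- The complexified space–time field of a classical solution is `C¹` on the slab. [folklore] -/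
theorem contDiffOn_uncurry_cplx (hv : (ofConstant A₀ A B₁).IsClassicalSolution T v) :
    ContDiffOn ℝ 1 (Function.uncurry fun s => cplx (v s)) (Icc 0 T ×ˢ univ) := by
  have h : (Function.uncurry fun s => cplx (v s)) = ofRealPi ∘ Function.uncurry v := rfl
  rw [h]
  exact ofRealPi.contDiff.comp_contDiffOn hv.contDiffOn

/-- The time derivative of the complexified field is the complexified time derivative
(interior times). [folklore] -/
theorem timeDeriv_cplx_eq (hv : (ofConstant A₀ A B₁).IsClassicalSolution T v) {t : ℝ}
    (ht : t ∈ Ioo 0 T) (x : Space d) :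
    timeDeriv (fun s => cplx (v s)) t x = ofRealPi (fderiv ℝ (Function.uncurry v) (t, x) (1, 0)) := by
  have h : (Function.uncurry fun s => cplx (v s)) = ofRealPi ∘ Function.uncurry v := rfl
  rw [timeDeriv_apply, h,
    (ofRealPi.hasFDerivAt.comp (t, x) (hv.differentiableAt_uncurry (p := (t, x)) ht).hasFDerivAt).fderiv]
  rfl

/-- **The complexified equation at interior times**:
`(A₀)_ℂ ∂ₜv_ℂ + Σⱼ (Aⱼ)_ℂ ∂ⱼv_ℂ(t) + (B₁)_ℂ v_ℂ(t) = 0`. [cite: Rauch1986, (4) p. 482] -/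
theorem eqn_cplx (hv : (ofConstant A₀ A B₁).IsClassicalSolution T v) {t : ℝ} (ht : t ∈ Ioo 0 T)
    (x : Space d) :
    A₀.map (algebraMap ℝ ℂ) *ᵥ timeDeriv (fun s => cplx (v s)) t x +
        ∑ j, (A j).map (algebraMap ℝ ℂ) *ᵥ fderiv ℝ (cplx (v t)) x (EuclideanSpace.single j 1) +
      (LinearMap.toMatrix' (B₁ : (Fin k → ℝ) →ₗ[ℝ] (Fin k → ℝ))).map (algebraMap ℝ ℂ) *ᵥ
        cplx (v t) x = 0 := by
  have h := hv.eqn_fderiv ht x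
  simp only [ofConstant_A0, ofConstant_A, ofConstant_B] at h
  have hB : B₁ (v t x) = LinearMap.toMatrix' (B₁ : (Fin k → ℝ) →ₗ[ℝ] (Fin k → ℝ)) *ᵥ v t x := by
    rw [LinearMap.toMatrix'_mulVec]; rfl
  have hslice : DifferentiableAt ℝ (v t) x :=
    ((hv.contDiff_slice (Ioo_subset_Icc_self ht)).differentiable one_ne_zero).differentiableAt
  have h2 := congr_arg ofRealPi h
  rw [map_add, map_sum, map_neg, hB, ofRealPi_mulVec, ofRealPi_mulVec] at h2
  simp_rw [ofRealPi_mulVec, ← hv.fderiv_slice_eq_fderiv ht x] at h2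
  rw [timeDeriv_cplx_eq hv ht x, cplx_apply]
  simp_rw [fderiv_cplx_apply hslice]
  rw [h2, neg_add_cancel]

/-- The complexified slices vanish where the solution does. [folklore] -/
theorem cplx_slice_eq_zero (hsupp : ∀ t ∈ Icc 0 T, ∀ x : Space d, ρ < ‖x‖ → v t x = 0) :
    ∀ t ∈ Icc 0 T, ∀ x : Space d, ρ < ‖x‖ → (fun s => cplx (v s)) t x = 0 := by
  intro t ht x hx
  change cplx (v t) x = 0
  rw [cplx_apply, hsupp t ht x hx, map_zero]

/-- At interior times the complexified time derivative is continuous and compactly supported,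
hence integrable. [folklore] -/
theorem integrable_timeDeriv_cplx (hv : (ofConstant A₀ A B₁).IsClassicalSolution T v)
    (hsupp : ∀ t ∈ Icc 0 T, ∀ x : Space d, ρ < ‖x‖ → v t x = 0) {t : ℝ} (ht : t ∈ Ioo 0 T) :
    Integrable (timeDeriv (fun s => cplx (v s)) t) := by
  have hdiff := contDiffOn_uncurry_cplx hv
  have ho : IsOpen (Ioo 0 T ×ˢ (univ : Set (Space d))) := isOpen_Ioo.prod isOpen_univ
  have hcD : ContinuousOn (fderiv ℝ (Function.uncurry fun s => cplx (v s))) (Ioo 0 T ×ˢ univ) :=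
    (hdiff.mono (prod_mono Ioo_subset_Icc_self subset_rfl)).continuousOn_fderiv_of_isOpen ho le_rfl
  have h1 : Continuous fun x : Space d => fderiv ℝ (Function.uncurry fun s => cplx (v s)) (t, x) :=
    (hcD.comp_continuous (continuous_const.prodMk continuous_id) fun x => ⟨ht, mem_univ x⟩ :)
  have h2 : Continuous (timeDeriv (fun s => cplx (v s)) t) :=
    (ContinuousLinearMap.apply ℝ (Fin k → ℂ) ((1 : ℝ), (0 : Space d))).continuous.comp h1
  refine h2.integrable_of_hasCompactSupport ?_
  refine HasCompactSupport.intro (isCompact_closedBall (0 : Space d) ρ) fun x hx => ?_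
  rw [Metric.mem_closedBall, dist_zero_right, not_le] at hx
  exact timeDeriv_eq_zero_of_norm_gt (cplx_slice_eq_zero hsupp) ht hx

/-- The complexified slices are `C¹` and compactly supported. [folklore] -/
theorem contDiff_cplx_slice (hv : (ofConstant A₀ A B₁).IsClassicalSolution T v) {t : ℝ}
    (ht : t ∈ Icc 0 T) : ContDiff ℝ 1 (cplx (v t)) :=
  (hv.contDiff_slice ht).cplx

/-- The complexified slices are compactly supported. [folklore] -/
theorem hasCompactSupport_cplx_slice (hsupp : ∀ t ∈ Icc 0 T, ∀ x : Space d, ρ < ‖x‖ → v t x = 0)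
    {t : ℝ} (ht : t ∈ Icc 0 T) : HasCompactSupport (cplx (v t)) := by
  refine HasCompactSupport.intro (isCompact_closedBall (0 : Space d) ρ) fun x hx => ?_
  rw [Metric.mem_closedBall, dist_zero_right, not_le] at hx
  rw [cplx_apply, hsupp t ht x hx, map_zero]

/-- **The Fourier transform of the equation**: at interior times,
`(A₀)_ℂ 𝓕(∂ₜv_ℂ(t))(ξ) + Σⱼ 2πiξⱼ (Aⱼ)_ℂ 𝓕(v_ℂ(t))(ξ) + (B₁)_ℂ 𝓕(v_ℂ(t))(ξ) = 0`, hence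
`𝓕(∂ₜv_ℂ(t))(ξ) = -rauchGenerator A₀ A B₁ ξ · 𝓕(v_ℂ(t))(ξ)`.
[cite: Rauch1986, Proof of Theorem p. 483; Brenner1973, Lemma 5.1 p. 96] -/
theorem fourier_timeDeriv_cplx_eq (hdet : A₀.det ≠ 0)
    (hv : (ofConstant A₀ A B₁).IsClassicalSolution T v)
    (hsupp : ∀ t ∈ Icc 0 T, ∀ x : Space d, ρ < ‖x‖ → v t x = 0) {t : ℝ} (ht : t ∈ Ioo 0 T)
    (ξ : Space d) :
    𝓕 (timeDeriv (fun s => cplx (v s)) t) ξ =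
      -(rauchGenerator A₀ A B₁ ξ *ᵥ 𝓕 (cplx (v t)) ξ) := by
  set c := algebraMap ℝ ℂ with hc
  set Bm : Matrix (Fin k) (Fin k) ℝ := LinearMap.toMatrix' (B₁ : (Fin k → ℝ) →ₗ[ℝ] (Fin k → ℝ))
    with hBm
  have htI : t ∈ Icc 0 T := Ioo_subset_Icc_self ht
  have hg : ContDiff ℝ 1 (cplx (v t)) := contDiff_cplx_slice hv htI
  have hgc : HasCompactSupport (cplx (v t)) := hasCompactSupport_cplx_slice hsupp htI
  have hgi : Integrable (cplx (v t)) := hg.continuous.integrable_of_hasCompactSupport hgc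
  have hDi : Integrable (timeDeriv (fun s => cplx (v s)) t) := integrable_timeDeriv_cplx hv hsupp ht
  -- integrability of the three kinds of terms
  have h1i : Integrable fun x => A₀.map c *ᵥ timeDeriv (fun s => cplx (v s)) t x :=
    (mulVecCLM (A₀.map c)).integrable_comp hDi
  have hDji : ∀ j : Fin d, Integrable fun x => fderiv ℝ (cplx (v t)) x (EuclideanSpace.single j 1) := by
    intro j
    refine ((hg.continuous_fderiv one_ne_zero).clm_apply continuous_const).integrable_of_hasCompactSupport ?_
    exact (hgc.fderiv ℝ).mono fun x hx => by
      simp only [Function.mem_support, ne_eq] at hx ⊢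
      intro h0
      exact hx (by rw [h0]; rfl)
  have h2i : ∀ j : Fin d, Integrable fun x =>
      (A j).map c *ᵥ fderiv ℝ (cplx (v t)) x (EuclideanSpace.single j 1) :=
    fun j => (mulVecCLM ((A j).map c)).integrable_comp (hDji j)
  have h12i : Integrable fun x => A₀.map c *ᵥ timeDeriv (fun s => cplx (v s)) t x +
      ∑ j, (A j).map c *ᵥ fderiv ℝ (cplx (v t)) x (EuclideanSpace.single j 1) :=
    h1i.add (integrable_finsetSum _ fun j _ => h2i j)
  have h3i : Integrable fun x => Bm.map c *ᵥ cplx (v t) x := (mulVecCLM (Bm.map c)).integrable_comp hgi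
  -- Fourier transform of the equation
  have key : 𝓕 (fun x => A₀.map c *ᵥ timeDeriv (fun s => cplx (v s)) t x +
      ∑ j, (A j).map c *ᵥ fderiv ℝ (cplx (v t)) x (EuclideanSpace.single j 1) +
        Bm.map c *ᵥ cplx (v t) x) ξ = 0 := by
    rw [show (fun x => A₀.map c *ᵥ timeDeriv (fun s => cplx (v s)) t x +
        ∑ j, (A j).map c *ᵥ fderiv ℝ (cplx (v t)) x (EuclideanSpace.single j 1) +
          Bm.map c *ᵥ cplx (v t) x) = fun _ => (0 : Fin k → ℂ) from funext fun x => eqn_cplx hv ht x]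
    exact fourier_zero_apply ξ
  rw [fourier_add_apply h12i h3i, fourier_add_apply h1i (integrable_finsetSum _ fun j _ => h2i j),
    fourier_finset_sum_apply h2i] at key
  have hF1 : 𝓕 (fun x => A₀.map c *ᵥ timeDeriv (fun s => cplx (v s)) t x) ξ =
      A₀.map c *ᵥ 𝓕 (timeDeriv (fun s => cplx (v s)) t) ξ :=
    congr_fun (fourier_mulVec (A₀.map c) hDi) ξ
  have hF2 : ∀ j, 𝓕 (fun x => (A j).map c *ᵥ fderiv ℝ (cplx (v t)) x (EuclideanSpace.single j 1)) ξ =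
      (A j).map c *ᵥ ((2 * Real.pi * ξ j * Complex.I) • 𝓕 (cplx (v t)) ξ) := by
    intro j
    rw [congr_fun (fourier_mulVec ((A j).map c) (hDji j)) ξ, fourier_fderiv_apply_single hg hgc ξ j]
  have hF3 : 𝓕 (fun x => Bm.map c *ᵥ cplx (v t) x) ξ = Bm.map c *ᵥ 𝓕 (cplx (v t)) ξ :=
    congr_fun (fourier_mulVec (Bm.map c) hgi) ξ
  rw [hF1, hF3, add_assoc] at key
  simp_rw [hF2] at key
  have hsolved := eq_neg_of_add_eq_zero_left key
  -- invert `(A₀)_ℂ`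
  have hinv : (A₀⁻¹).map c * A₀.map c = 1 := by
    rw [← Matrix.map_mul, nonsing_inv_mul _ (isUnit_iff_ne_zero.2 hdet),
      Matrix.map_one c (map_zero c) (map_one c)]
  calc 𝓕 (timeDeriv (fun s => cplx (v s)) t) ξ
      = (A₀⁻¹).map c *ᵥ (A₀.map c *ᵥ 𝓕 (timeDeriv (fun s => cplx (v s)) t) ξ) := by
        rw [mulVec_mulVec, hinv, one_mulVec]
    _ = -((A₀⁻¹).map c *ᵥ (∑ j, (A j).map c *ᵥ ((2 * Real.pi * ξ j * Complex.I) • 𝓕 (cplx (v t)) ξ) +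
          Bm.map c *ᵥ 𝓕 (cplx (v t)) ξ)) := by rw [hsolved, mulVec_neg]
    _ = -(rauchGenerator A₀ A B₁ ξ *ᵥ 𝓕 (cplx (v t)) ξ) := by
        congr 1
        rw [rauchGenerator, ← hBm, ← mulVec_mulVec, add_mulVec, Matrix.sum_mulVec]
        congr 2
        refine Finset.sum_congr rfl fun j _ => ?_
        rw [smul_mulVec, mulVec_smul]

/-- **Fourier representation of compactly supported classical solutions** of the
constant-coefficient system: for `A₀` invertible and a classical solution `v` of
`A₀∂ₜv + Σ Aⱼ∂ⱼv + B₁v = 0` on `[0, T] × ℝᵈ` vanishing for `‖x‖ > ρ` (all `t ∈ [0, T]`),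
`𝓕(v_ℂ(t))(ξ) = rauchSymbol A₀ A B₁ t ξ · 𝓕(v_ℂ(0))(ξ)` for all `t ∈ [0, T]`, `ξ ∈ ℝᵈ`:
Rauch's multiplier `exp(-t A₀⁻¹(2πi Σ ξⱼAⱼ + B₁))` is the solution symbol, and such solutions
are determined by their data. [cite: Rauch1986, Proof of Theorem p. 483;
Brenner1973, Lemma 5.1 (5.12) p. 96] -/
theorem fourier_cplx_slice_eq_rauchSymbol_mulVec (hdet : A₀.det ≠ 0)
    (hv : (ofConstant A₀ A B₁).IsClassicalSolution T v)
    (hsupp : ∀ t ∈ Icc 0 T, ∀ x : Space d, ρ < ‖x‖ → v t x = 0) {t : ℝ} (ht : t ∈ Icc 0 T)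
    (ξ : Space d) :
    𝓕 (cplx (v t)) ξ = rauchSymbol A₀ A B₁ t ξ *ᵥ 𝓕 (cplx (v 0)) ξ := by
  have hdiff := contDiffOn_uncurry_cplx hv
  have hsuppu := cplx_slice_eq_zero hsupp
  have hwc : ContinuousOn (fun s => 𝓕 ((fun s => cplx (v s)) s) ξ) (Icc 0 T) :=
    continuousOn_fourier_slice hdiff.continuousOn hsuppu ξ
  have hwd : ∀ s ∈ Ioo 0 T, HasDerivAt (fun s => 𝓕 ((fun s => cplx (v s)) s) ξ)
      (-(rauchGenerator A₀ A B₁ ξ *ᵥ (fun s => 𝓕 ((fun s => cplx (v s)) s) ξ) s)) s := by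
    intro s hs
    have h := hasDerivAt_fourier_slice hdiff hsuppu hs ξ
    rw [fourier_timeDeriv_cplx_eq hdet hv hsupp hs ξ] at h
    exact h
  exact eq_exp_neg_mulVec_of_hasDerivAt hwc hwd ht

/-- **The same, with the support supplied by finite speed of propagation**: if the
constant-coefficient system propagates the constant state `0` with speed `c ≥ 0`
(`HasPropagationSpeed (ofConstant A₀ A B₁) 0 c`; discharged for the symmetrizable branch of
Rauch's class, `Rauch1986_finitePropagationSpeed_symmetrizable_holds`), then every classical
solution with compactly supported data has the Fourier representation
`𝓕(v_ℂ(t)) = rauchSymbol A₀ A B₁ t · 𝓕(v_ℂ(0))` on `[0, T]`. [cite: Rauch1986, Proof of Theorem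
pp. 482–483] -/
theorem fourier_cplx_slice_eq_of_hasPropagationSpeed (hdet : A₀.det ≠ 0) {c : ℝ} (hc : 0 ≤ c)
    (hps : (ofConstant A₀ A B₁).HasPropagationSpeed 0 c)
    (hv : (ofConstant A₀ A B₁).IsClassicalSolution T v) (h0 : HasCompactSupport (v 0)) {t : ℝ}
    (ht : t ∈ Icc 0 T) (ξ : Space d) :
    𝓕 (cplx (v t)) ξ = rauchSymbol A₀ A B₁ t ξ *ᵥ 𝓕 (cplx (v 0)) ξ := by
  obtain ⟨R, hR⟩ := exists_eq_zero_of_norm_gt h0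
  have hsupp : ∀ s ∈ Icc 0 T, ∀ x : Space d, R + c * T < ‖x‖ → v s x = 0 := by
    intro s hs x hx
    refine hps T R v hv hR s hs x (lt_of_le_of_lt ?_ hx)
    have := mul_le_mul_of_nonneg_left hs.2 hc
    linarith
  exact fourier_cplx_slice_eq_rauchSymbol_mulVec hdet hv hsupp ht ξ

end Solution

end Literature.Barriers.AtomisticToContinuum

end
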